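import Summits.QuantumFields.YangMills.Theorems.LuscherReductionTwistedTraceScalingBOCentralSmearing
import HarnessLib

/-!
# THE CORE DEFECT, POINTWISE IN THE OUTPUT POINT, FOR SIGNED SLOW AMPLITUDES
# (lane A of S-BASE, crux `TwistedTraceScaling` stmt-QuantumFields-20203, C4-CORE, the (OD) pen; step (C4)-core of `pub/ym-fleet/ym-luscher-20007-p1/COARSE-DESIGN.md` §27.7)

`…BOCoreTransfer.colour_fpFibreTransfer_two_sided` sandwiches, for EACH input slow point `u` in the window, the colour integral of the core fibre transfer
`I(u) = ∫_c fpFibreTransfer β Ω W (c⁻¹(oT u' v')c) u dc` between `e^{∓η}(1∓η_c)·A·ρ̃(u)`, `A = c₁P(v̂')`, `ρ̃(u) = K̃₁(u',u)/K₁(1,1)`.  Because the sandwich is pointwise in `u`,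
SIGNED slow amplitudes cost nothing: for every bounded measurable `φ` supported in the window,
★★★ `core_transfer_defect_le`:  `|∫_u φ(u)·I(u) du − A·∫_u φ(u)ρ̃(u) du| ≤ ε·A·∫_u |φ(u)|ρ̃(u) du`,  `ε = max(1 − e^{−η}(1−η_c), e^{η}(1+η_c) − 1)`
(`c₁ ≥ 0`, `P ≥ 0`).  With `…BOColourAssembly.fibreTransfer_fp` + `transferApply_boFun_eq` the left integral is `Z·K̃(φ⊗Ω)(oT u' v')` restricted to the core weight, and the right side is
`ε·(c₁P(v̂')/K₁(1,1))·(K̃₁|φ|)(u')` — the pointwise core estimate of COARSE-DESIGN §27.3 (a) / §27.7 (C4), whose `L²(w)` size is then controlled by `…BOSlowSchur` and (P).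
Also: `measurable_colour_fpFibreTransfer` (joint measurability in the input slow point), `abs_colour_fpFibreTransfer_le`.
HONEST FRAMING: bookkeeping for a stub of a child of the CONDITIONAL route R2b1; (C1c), (C1d), tails, (B-ST) OPEN; C4-CORE OPEN; not infinite volume, not a gap, not Clay.
-/

set_option autoImplicit false

noncomputable section

open MeasureTheory Filter Topology Real
open scoped BigOperators
open Literature.MathematicalPhysics.QuantumFieldTheory
open Literature.MathematicalPhysics.QuantumLattice

namespace Summit.QuantumFields.YangMills.Theorems.FemtoTransferGap.TwoLattice.ConstTube

open Summit.QuantumFields.YangMills.Theorems.FemtoTransferGap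
open Summit.QuantumFields.YangMills.Theorems.FemtoTransferGap.TwoLattice
open Summit.QuantumFields.YangMills.Theorems.FemtoTransferGap.TwoLattice.Avg
open Summit.QuantumFields.YangMills.Theorems.FemtoTransferGap.TwoLattice.Stiff (LinkSpace)

variable {L : ℕ} [NeZero L]

/-! ## §1 The colour integral of the fibre transfer is measurable and bounded in the input slow point -/

/-- `u ↦ ∫_c fpFibreTransfer β Ω W (c⁻¹U'c) u dc` is measurable. [folklore] -/
theorem measurable_colour_fpFibreTransfer (β : ℝ) {Ω : LinkSpace L → ℝ} (hΩ : Measurable Ω) {W : (Site 3 L → SU2) → ℝ} (hW : Measurable W) (U' : GaugeConfig 3 L SU2) :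
    Measurable fun u : GaugeConfig 3 1 SU2 => ∫ c, fpFibreTransfer L β Ω W (gaugeTransform (fun _ : Site 3 L => c⁻¹) U') u ∂haarProbability SU2 := by
  haveI : SecondCountableTopology SU2 := secondCountableTopology_su2
  haveI := isFiniteMeasure_orthoTransverse L
  have hK : Measurable fun p : GaugeConfig 3 L SU2 × GaugeConfig 3 L SU2 => transferKernel su2Rep β p.1 p.2 :=
    (continuous_transferKernel su2Rep continuous_su2Rep β).measurable
  -- the integrand on `((u, c), (v, g))`
  have h1 : Measurable fun q : (GaugeConfig 3 1 SU2 × SU2) × ((Edge 3 L → Fin 3 → ℝ) × (Site 3 L → SU2)) => gaugeTransform (fun _ : Site 3 L => q.1.2⁻¹) U' := by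
    have hc : Measurable fun _ : (GaugeConfig 3 1 SU2 × SU2) × ((Edge 3 L → Fin 3 → ℝ) × (Site 3 L → SU2)) => U' := measurable_const
    have hcinv : Measurable fun q : (GaugeConfig 3 1 SU2 × SU2) × ((Edge 3 L → Fin 3 → ℝ) × (Site 3 L → SU2)) => q.1.2⁻¹ :=
      (measurable_snd.comp measurable_fst).inv
    have ha : Measurable fun q : (GaugeConfig 3 1 SU2 × SU2) × ((Edge 3 L → Fin 3 → ℝ) × (Site 3 L → SU2)) => (U', q.1.2⁻¹) := hc.prodMk hcinv
    have h := (measurable_constGaugeAction (L := L)).comp ha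
    simpa only [Function.comp_def] using h
  have h2 : Measurable fun q : (GaugeConfig 3 1 SU2 × SU2) × ((Edge 3 L → Fin 3 → ℝ) × (Site 3 L → SU2)) => gaugeTransform q.2.2 (orthoTube L q.1.1 q.2.1) := by
    have hf : Measurable fun q : (GaugeConfig 3 1 SU2 × SU2) × ((Edge 3 L → Fin 3 → ℝ) × (Site 3 L → SU2)) => (q.1.1, q.2.1) :=
      (measurable_fst.comp measurable_fst).prodMk (measurable_fst.comp measurable_snd)
    have ho' := (measurable_orthoTube_uncurry (L := L)).comp hf
    have ho : Measurable fun q : (GaugeConfig 3 1 SU2 × SU2) × ((Edge 3 L → Fin 3 → ℝ) × (Site 3 L → SU2)) => orthoTube L q.1.1 q.2.1 := by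
      simpa only [Function.comp_def] using ho'
    have hg : Measurable fun q : (GaugeConfig 3 1 SU2 × SU2) × ((Edge 3 L → Fin 3 → ℝ) × (Site 3 L → SU2)) => (orthoTube L q.1.1 q.2.1, q.2.2) :=
      ho.prodMk (measurable_snd.comp measurable_snd)
    have h := (measurable_gaugeAction (L := L)).comp hg
    simpa only [Function.comp_def] using h
  have h3 : Measurable fun q : (GaugeConfig 3 1 SU2 × SU2) × ((Edge 3 L → Fin 3 → ℝ) × (Site 3 L → SU2)) =>
      transferKernel su2Rep β (gaugeTransform (fun _ : Site 3 L => q.1.2⁻¹) U') (gaugeTransform q.2.2 (orthoTube L q.1.1 q.2.1)) := by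
    have h := hK.comp (h1.prodMk h2); simpa only [Function.comp_def] using h
  have hF : Measurable fun q : (GaugeConfig 3 1 SU2 × SU2) × ((Edge 3 L → Fin 3 → ℝ) × (Site 3 L → SU2)) =>
      W q.2.2 * transferKernel su2Rep β (gaugeTransform (fun _ : Site 3 L => q.1.2⁻¹) U') (gaugeTransform q.2.2 (orthoTube L q.1.1 q.2.1)) * Ω (linkEmbed L q.2.1) :=
    ((hW.comp (measurable_snd.comp measurable_snd)).mul h3).mul (hΩ.comp ((measurable_linkEmbed L).comp (measurable_fst.comp measurable_snd)))
  have hI := (hF.stronglyMeasurable.integral_prod_right' (ν := (orthoTransverse L).prod (gaugeMeasure L))).measurable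
  have hI' : Measurable fun r : GaugeConfig 3 1 SU2 × SU2 => fpFibreTransfer L β Ω W (gaugeTransform (fun _ : Site 3 L => r.2⁻¹) U') r.1 := by
    unfold fpFibreTransfer; simpa only using hI
  have hJ := (hI'.stronglyMeasurable.integral_prod_right' (ν := haarProbability SU2)).measurable
  simpa only using hJ

/-- Uniform bound: `|fpFibreTransfer β Ω W U u| ≤ C_W·M·C_Ω·(π⊗dg)(univ)` for all `U, u`. [folklore] -/
theorem abs_fpFibreTransfer_le' (β : ℝ) {Ω : LinkSpace L → ℝ} {CΩ : ℝ} (hCΩ : ∀ x, |Ω x| ≤ CΩ) {W : (Site 3 L → SU2) → ℝ} {CW : ℝ} (hCW : ∀ g, |W g| ≤ CW) :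
    ∃ B : ℝ, ∀ (U : GaugeConfig 3 L SU2) (u : GaugeConfig 3 1 SU2), |fpFibreTransfer L β Ω W U u| ≤ B := by
  haveI := isFiniteMeasure_orthoTransverse L
  obtain ⟨M, hM⟩ := exists_transferKernel_le su2Rep continuous_su2Rep β (L := L)
  have hCW0 : 0 ≤ CW := (abs_nonneg _).trans (hCW 1)
  have hM0 : 0 ≤ M := (transferKernel_pos su2Rep β (1 : GaugeConfig 3 L SU2) 1).le.trans (hM 1 1)
  refine ⟨CW * M * CΩ * ((orthoTransverse L).prod (gaugeMeasure L)).real Set.univ, fun U u => ?_⟩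
  have hb : ∀ p : (Edge 3 L → Fin 3 → ℝ) × (Site 3 L → SU2), |W p.2 * transferKernel su2Rep β U (gaugeTransform p.2 (orthoTube L u p.1)) * Ω (linkEmbed L p.1)| ≤ CW * M * CΩ :=
    fun p => by
      rw [abs_mul, abs_mul, abs_of_pos (transferKernel_pos su2Rep β _ _)]
      exact mul_le_mul (mul_le_mul (hCW _) (hM _ _) (transferKernel_pos su2Rep β _ _).le hCW0) (hCΩ _) (abs_nonneg _) (mul_nonneg hCW0 hM0)
  unfold fpFibreTransfer
  calc |∫ p, W p.2 * transferKernel su2Rep β U (gaugeTransform p.2 (orthoTube L u p.1)) * Ω (linkEmbed L p.1) ∂(orthoTransverse L).prod (gaugeMeasure L)|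
      ≤ ∫ p, |W p.2 * transferKernel su2Rep β U (gaugeTransform p.2 (orthoTube L u p.1)) * Ω (linkEmbed L p.1)| ∂(orthoTransverse L).prod (gaugeMeasure L) :=
        abs_integral_le_integral_abs
    _ ≤ ∫ _p, CW * M * CΩ ∂(orthoTransverse L).prod (gaugeMeasure L) :=
        integral_mono_of_nonneg (ae_of_all _ fun _ => abs_nonneg _) (integrable_const _) (ae_of_all _ hb)
    _ = CW * M * CΩ * ((orthoTransverse L).prod (gaugeMeasure L)).real Set.univ := by rw [integral_const, smul_eq_mul, Measure.real]; ring

/-- `|∫_c fpFibreTransfer β Ω W (c⁻¹U'c) u dc| ≤ B` uniformly in `u`. [folklore] -/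
theorem abs_colour_fpFibreTransfer_le (β : ℝ) {Ω : LinkSpace L → ℝ} {CΩ : ℝ} (hCΩ : ∀ x, |Ω x| ≤ CΩ) {W : (Site 3 L → SU2) → ℝ} {CW : ℝ} (hCW : ∀ g, |W g| ≤ CW)
    (U' : GaugeConfig 3 L SU2) :
    ∃ B : ℝ, ∀ u : GaugeConfig 3 1 SU2, |∫ c, fpFibreTransfer L β Ω W (gaugeTransform (fun _ : Site 3 L => c⁻¹) U') u ∂haarProbability SU2| ≤ B := by
  obtain ⟨B, hB⟩ := abs_fpFibreTransfer_le' (L := L) β hCΩ hCW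
  refine ⟨B, fun u => ?_⟩
  calc |∫ c, fpFibreTransfer L β Ω W (gaugeTransform (fun _ : Site 3 L => c⁻¹) U') u ∂haarProbability SU2|
      ≤ ∫ c, |fpFibreTransfer L β Ω W (gaugeTransform (fun _ : Site 3 L => c⁻¹) U') u| ∂haarProbability SU2 := abs_integral_le_integral_abs
    _ ≤ ∫ _c, B ∂haarProbability SU2 := integral_mono_of_nonneg (ae_of_all _ fun _ => abs_nonneg _) (integrable_const _) (ae_of_all _ fun c => hB _ u)
    _ = B := by simp

/-! ## §2 ★★★ The core defect for signed slow amplitudes -/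

/-- ★★★ **THE CORE DEFECT FOR SIGNED SLOW AMPLITUDES** (see the module docstring; hypotheses as in `colour_fpFibreTransfer_two_sided`, plus `c₁ ≥ 0`, `P ≥ 0`, and `φ` bounded measurable
supported in the `δu`-window with one-site action `≤ σ/L³`). [cite: Luscher1983, §3] -/
theorem core_transfer_defect_le {β : ℝ} (hβ : 0 ≤ β) {Ω : LinkSpace L → ℝ} (hΩm : Measurable Ω) {CΩ : ℝ} (hCΩ : ∀ x, |Ω x| ≤ CΩ) (hΩ0 : ∀ x, 0 ≤ Ω x)
    {W : (Site 3 L → SU2) → ℝ} (hW : Measurable W) {CW : ℝ} (hCW : ∀ g, |W g| ≤ CW) (hW0 : ∀ g, 0 ≤ W g)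
    {δ δu T R Γ σ : ℝ} (hδ1 : δ ≤ 1 / 2) (hα1 : δ + δu ≤ 1) (hT0 : 0 ≤ T) (hT : T ≤ 1 / 30) (hσ : σ < 2)
    (hΩt : ∀ v : Edge 3 L → Fin 3 → ℝ, Ω (linkEmbed L v) ≠ 0 → v ∈ capBalancedSet L ∧ (∀ (e : Edge 3 L) (c : Fin 3), |v e c| ≤ T) ∧ ‖linkEmbed L v‖ ≤ R)
    (hWc : ∀ g : Site 3 L → SU2, W g ≠ 0 → (∀ x, ‖su2Quat (g x) - 1‖ ≤ T) ∧ ‖∑ x, vecPart (g x)‖ ≤ Γ)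
    {P : LinkSpace L → ℝ} (hP0 : ∀ x, 0 ≤ P x) (hPinv : ∀ (g : SU2) (x : LinkSpace L), P (adL L g x) = P x) {c₁ ηc : ℝ} (hc₁ : 0 ≤ c₁)
    (hC1 : ∀ v'' : Edge 3 L → Fin 3 → ℝ, v'' ∈ capBalancedSet L → (∀ (e : Edge 3 L) (a : Fin 3), |v'' e a| ≤ T) → ‖linkEmbed L v''‖ ≤ R →
      |fpFibreTransfer L β Ω W (orthoTube L 1 v'') 1 - c₁ * P (linkEmbed L v'')| ≤ ηc * (c₁ * P (linkEmbed L v'')))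
    (u' : GaugeConfig 3 1 SU2) (hu' : ∀ k : Fin 3, ‖su2Quat (u' (0, k)) - 1‖ ≤ δ) (hS' : (L : ℝ) ^ 3 * wilsonAction su2Rep u' ≤ σ)
    {v' : Edge 3 L → Fin 3 → ℝ} (hv' : v' ∈ capBalancedSet L) (hv'T : ∀ e : Edge 3 L, ∑ a, v' e a ^ 2 ≤ T ^ 2) (hx' : ‖linkEmbed L v'‖ ≤ R)
    {φ : GaugeConfig 3 1 SU2 → ℝ} (hφm : Measurable φ) {Cφ : ℝ} (hCφ : ∀ u, |φ u| ≤ Cφ)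
    (hφw : ∀ u, φ u ≠ 0 → (∀ k : Fin 3, ‖su2Quat (u (0, k)) - 1‖ ≤ δu) ∧ (L : ℝ) ^ 3 * wilsonAction su2Rep u ≤ σ) :
    |(∫ u, φ u * (∫ c, fpFibreTransfer L β Ω W (gaugeTransform (fun _ : Site 3 L => c⁻¹) (orthoTube L u' v')) u ∂haarProbability SU2) ∂configMeasure SU2 1) -
        c₁ * P (linkEmbed L v') *
          ∫ u, φ u * (avgKernel ((L : ℝ) ^ 3 * β) u' u / transferKernel su2Rep ((L : ℝ) ^ 3 * β) (1 : GaugeConfig 3 1 SU2) 1) ∂configMeasure SU2 1| ≤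
      max (1 - Real.exp (-(coreEta L β δ (δ + δu) T R Γ σ + coreEps1 L β δ T R + coreEps2 L β δ T R σ)) * (1 - ηc))
          (Real.exp (coreEta L β δ (δ + δu) T R Γ σ + coreEps1 L β δ T R + coreEps2 L β δ T R σ) * (1 + ηc) - 1) *
        (c₁ * P (linkEmbed L v') *
          ∫ u, |φ u| * (avgKernel ((L : ℝ) ^ 3 * β) u' u / transferKernel su2Rep ((L : ℝ) ^ 3 * β) (1 : GaugeConfig 3 1 SU2) 1) ∂configMeasure SU2 1) := by
  set B : ℝ := (L : ℝ) ^ 3 * β with hB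
  set η : ℝ := coreEta L β δ (δ + δu) T R Γ σ + coreEps1 L β δ T R + coreEps2 L β δ T R σ with hη
  set A : ℝ := c₁ * P (linkEmbed L v') with hA
  set ε : ℝ := max (1 - Real.exp (-η) * (1 - ηc)) (Real.exp η * (1 + ηc) - 1) with hε
  set I : GaugeConfig 3 1 SU2 → ℝ := fun u => ∫ c, fpFibreTransfer L β Ω W (gaugeTransform (fun _ : Site 3 L => c⁻¹) (orthoTube L u' v')) u ∂haarProbability SU2 with hI
  set ρ : GaugeConfig 3 1 SU2 → ℝ := fun u => avgKernel B u' u / transferKernel su2Rep B (1 : GaugeConfig 3 1 SU2) 1 with hρ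
  have hA0 : 0 ≤ A := mul_nonneg hc₁ (hP0 _)
  have hK1 : 0 < transferKernel su2Rep B (1 : GaugeConfig 3 1 SU2) 1 := transferKernel_pos _ _ _ _
  have hρ0 : ∀ u, 0 ≤ ρ u := fun u => div_nonneg (avgKernel_pos B _ _).le hK1.le
  have hCφ0 : 0 ≤ Cφ := (abs_nonneg _).trans (hCφ 1)
  -- pointwise defect in `u`
  have hpt : ∀ u, |φ u * I u - A * (φ u * ρ u)| ≤ ε * (A * (|φ u| * ρ u)) := by
    intro u
    by_cases hu : φ u = 0
    · rw [hu]; simp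
    · obtain ⟨huw, hSu⟩ := hφw u hu
      have h2 := colour_fpFibreTransfer_two_sided hβ hΩm hCΩ hΩ0 hW hCW hW0 hδ1 hα1 hT0 hT hσ hΩt hWc hPinv hC1 u' u hu' hS' huw hSu hv' hv'T hx'
      rw [← hB, ← hη] at h2
      obtain ⟨hlo, hhi⟩ := h2
      have hAρ : 0 ≤ A * ρ u := mul_nonneg hA0 (hρ0 u)
      -- `|I u − Aρ u| ≤ ε·Aρ u`
      have hd : |I u - A * ρ u| ≤ ε * (A * ρ u) := by
        rw [abs_le]
        constructor
        · have h1 : (1 - Real.exp (-η) * (1 - ηc)) * (A * ρ u) ≤ ε * (A * ρ u) := mul_le_mul_of_nonneg_right (le_max_left _ _) hAρ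
          have h2' : Real.exp (-η) * (1 - ηc) * (A * ρ u) ≤ I u := by rw [hI, hA, hρ]; exact hlo
          nlinarith
        · have h1 : (Real.exp η * (1 + ηc) - 1) * (A * ρ u) ≤ ε * (A * ρ u) := mul_le_mul_of_nonneg_right (le_max_right _ _) hAρ
          have h2' : I u ≤ Real.exp η * (1 + ηc) * (A * ρ u) := by rw [hI, hA, hρ]; exact hhi
          nlinarith
      calc |φ u * I u - A * (φ u * ρ u)| = |φ u| * |I u - A * ρ u| := by rw [← abs_mul]; ring_nf
        _ ≤ |φ u| * (ε * (A * ρ u)) := mul_le_mul_of_nonneg_left hd (abs_nonneg _)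
        _ = ε * (A * (|φ u| * ρ u)) := by ring
  -- integrability
  obtain ⟨BI, hBI⟩ := abs_colour_fpFibreTransfer_le (L := L) β hCΩ hCW (orthoTube L u' v')
  have hIm : Measurable I := measurable_colour_fpFibreTransfer β hΩm hW (orthoTube L u' v')
  obtain ⟨M1, hM10, hM1⟩ := exists_avgKernel_le (L := 1) B
  have hρm : Measurable ρ := (measurable_avgKernel_right (L := 1) B u').div_const _
  have hρb : ∀ u, |ρ u| ≤ M1 / transferKernel su2Rep B (1 : GaugeConfig 3 1 SU2) 1 := fun u => by
    rw [abs_of_nonneg (hρ0 u)]; exact div_le_div_of_nonneg_right (hM1 _ _) hK1.le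
  have iφI : Integrable (fun u => φ u * I u) (configMeasure SU2 1) :=
    integrable_of_measurable_abs_le _ (hφm.mul hIm) (C := Cφ * BI) fun u => by rw [abs_mul]; exact mul_le_mul (hCφ u) (hBI u) (abs_nonneg _) hCφ0
  have iφρ : Integrable (fun u => φ u * ρ u) (configMeasure SU2 1) :=
    integrable_of_measurable_abs_le _ (hφm.mul hρm) (C := Cφ * (M1 / transferKernel su2Rep B (1 : GaugeConfig 3 1 SU2) 1)) fun u => by
      rw [abs_mul]; exact mul_le_mul (hCφ u) (hρb u) (abs_nonneg _) hCφ0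
  have iaφρ : Integrable (fun u => |φ u| * ρ u) (configMeasure SU2 1) :=
    integrable_of_measurable_abs_le _ (hφm.abs.mul hρm) (C := Cφ * (M1 / transferKernel su2Rep B (1 : GaugeConfig 3 1 SU2) 1)) fun u => by
      rw [abs_mul, abs_abs]; exact mul_le_mul (hCφ u) (hρb u) (abs_nonneg _) hCφ0
  -- integrate
  have hIdef : (∫ u, φ u * (∫ c, fpFibreTransfer L β Ω W (gaugeTransform (fun _ : Site 3 L => c⁻¹) (orthoTube L u' v')) u ∂haarProbability SU2) ∂configMeasure SU2 1) =
      ∫ u, φ u * I u ∂configMeasure SU2 1 := rfl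
  have hρdef : ∫ u, φ u * (avgKernel B u' u / transferKernel su2Rep B (1 : GaugeConfig 3 1 SU2) 1) ∂configMeasure SU2 1 = ∫ u, φ u * ρ u ∂configMeasure SU2 1 := rfl
  have hρdef' : ∫ u, |φ u| * (avgKernel B u' u / transferKernel su2Rep B (1 : GaugeConfig 3 1 SU2) 1) ∂configMeasure SU2 1 = ∫ u, |φ u| * ρ u ∂configMeasure SU2 1 := rfl
  rw [hIdef, hρdef, hρdef', ← integral_const_mul, ← integral_sub iφI (iφρ.const_mul A), ← integral_const_mul, ← integral_const_mul]
  calc |∫ u, φ u * I u - A * (φ u * ρ u) ∂configMeasure SU2 1| ≤ ∫ u, |φ u * I u - A * (φ u * ρ u)| ∂configMeasure SU2 1 := abs_integral_le_integral_abs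
    _ ≤ ∫ u, ε * (A * (|φ u| * ρ u)) ∂configMeasure SU2 1 :=
        integral_mono_of_nonneg (ae_of_all _ fun _ => abs_nonneg _) ((iaφρ.const_mul A).const_mul ε) (ae_of_all _ hpt)

end Summit.QuantumFields.YangMills.Theorems.FemtoTransferGap.TwoLattice.ConstTube

end
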